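import Mathlib.RingTheory.Polynomial.Resultant.Basic
import Mathlib.FieldTheory.Separable
import Mathlib.FieldTheory.RatFunc.Basic
import Mathlib.Algebra.Polynomial.Bivariate
import HarnessLib

/-!
# Inseparable fibres of a plane model: at most `d(d-1)` of them

Elementary bookkeeping for the fibrewise count of the rational points of a plane curve
`Φ(X, Y) = 0` over a finite field (`PlaneCurvePointCountProofs`, Weil's estimate for the *number*
of points of a possibly singular plane model, the input "Lemma 5.1 = [Sch74, Lemma 5]" of
Cafure–Matera's proof of their Thm. 5.2). For `Φ ∈ K[X][Y]` monic of degree `d` in `Y` and of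
total degree `d` (`deg_X (coeff of Yⁱ) + i ≤ d`), separable over `K(X)`:

* `natDegree_resultant_le_mul`: a weighted form of the degree bound for Sylvester determinants —
  if `deg_X (coeff_k f) + k ≤ m` and `deg_X (coeff_k g) + k ≤ n` then
  `deg_X Res_Y^{m,n}(f, g) ≤ m n` (the resultant of two plane curves of degrees `m`, `n` has
  degree `≤ mn`, the numerical half of Bézout's theorem);
* `card_filter_not_separable_le`: the number of `a ∈ K` for which the fibre polynomial
  `Φ(a, Y) ∈ K[Y]` is not separable is at most `d(d-1)` (they are roots of
  `Res_Y(Φ, ∂Φ/∂Y) ≠ 0`, of degree `≤ d(d-1)`);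
* `card_filter_evalEval_eq_sum`, `card_filter_evalEval_le`: `#{Φ = 0} = ∑ₐ #{b : Φ(a,b) = 0}`
  and each fibre has at most `d` points.

No definitions are introduced.

## References

* A. Cafure, G. Matera, *Improved explicit estimates on the number of solutions of equations over
  a finite field*, Finite Fields Appl. 12 (2006) 155–185, Lemma 5.1. [CafureMatera2006]
* W. M. Schmidt, *A lower bound for the number of solutions of equations over finite fields*,
  J. reine angew. Math. 274/275 (1975) 310–352, Lemma 5. [Schmidt1974]
-/

noncomputable section

open scoped Classical Polynomial.Bivariate
open Polynomial

namespace Literature.NumberTheory.DiophantineGeometry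

/-! ### Degree of a determinant, permutation by permutation -/

section Det

variable {R : Type*} [CommRing R] {n : Type*} [Fintype n] [DecidableEq n]

/-- If along every permutation with no zero entry the degrees of the entries sum to at most `B`,
then `deg det M ≤ B`. [folklore] -/
theorem natDegree_det_le_of_forall_perm (M : Matrix n n R[X]) (B : ℕ)
    (hM : ∀ σ : Equiv.Perm n, (∀ i, M (σ i) i ≠ 0) → ∑ i, (M (σ i) i).natDegree ≤ B) :
    M.det.natDegree ≤ B := by
  rw [Matrix.det_apply']
  refine natDegree_sum_le_of_forall_le _ _ fun σ _ ↦ ?_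
  by_cases h : ∀ i, M (σ i) i ≠ 0
  · refine natDegree_mul_le.trans ?_
    rw [natDegree_intCast, zero_add]
    exact (natDegree_prod_le _ _).trans (hM σ h)
  · push Not at h
    obtain ⟨i, hi⟩ := h
    rw [Finset.prod_eq_zero (f := fun i ↦ M (σ i) i) (Finset.mem_univ i) hi, mul_zero,
      natDegree_zero]
    exact Nat.zero_le _

end Det

/-! ### The weighted degree bound for resultants -/

section Resultant

variable {A : Type*} [CommRing A]

/-- `∑_{i < k} i` over `Fin k`, doubled. [folklore] -/
theorem two_mul_sum_fin_val (k : ℕ) : 2 * ∑ i : Fin k, (i : ℕ) = k * (k - 1) := by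
  rw [Fin.sum_univ_eq_sum_range (fun i ↦ i) k, mul_comm 2, Finset.sum_range_id_mul_two]

/-- **Weighted degree bound for the resultant.** If `f, g ∈ A[X][Y]` satisfy
`deg_X (coeff_k f) + k ≤ m` (`k ≤ m`) and `deg_X (coeff_k g) + k ≤ n` (`k ≤ n`) — e.g. plane
curves of total degrees `m` and `n` — then `deg_X Res_Y^{m,n}(f, g) ≤ m n`: along a permutation
`σ` of the Sylvester matrix the entry in column `j` has degree at most `w(j) - σ(j)` for the
column weights `w = (n, n+1, …, n+m-1, m, m+1, …, m+n-1)`, and `∑ w(j) - ∑ σ(j) = mn`.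
[folklore] -/
theorem natDegree_resultant_le_mul (f g : A[X][Y]) (m n : ℕ)
    (hf : ∀ k, k ≤ m → (f.coeff k).natDegree + k ≤ m)
    (hg : ∀ k, k ≤ n → (g.coeff k).natDegree + k ≤ n) :
    (resultant f g m n).natDegree ≤ m * n := by
  -- column weights
  let w : Fin (m + n) → ℕ := fun j ↦ j.addCases (fun j₁ ↦ n + (j₁ : ℕ)) (fun j₁ ↦ m + (j₁ : ℕ))
  have hw : ∑ j, w j = 2 * (m * n) + ∑ j₁ : Fin m, (j₁ : ℕ) + ∑ j₁ : Fin n, (j₁ : ℕ) := by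
    rw [Fin.sum_univ_add]
    simp only [w, Fin.addCases_left, Fin.addCases_right, Finset.sum_add_distrib,
      Finset.sum_const, Finset.card_univ, Fintype.card_fin, smul_eq_mul]
    ring
  -- the key estimate on the entries
  have hentry : ∀ (i j : Fin (m + n)), sylvester f g m n i j ≠ 0 →
      (sylvester f g m n i j).natDegree + (i : ℕ) ≤ w j := by
    intro i j
    induction j using Fin.addCases with
    | left j₁ =>
      simp only [sylvester, Matrix.of_apply, Fin.addCases_left, w]
      split_ifs with hi
      · intro _
        rw [Set.mem_Icc] at hi
        have := hg ((i : ℕ) - j₁) (by omega)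
        omega
      · intro h; exact absurd rfl h
    | right j₁ =>
      simp only [sylvester, Matrix.of_apply, Fin.addCases_right, w]
      split_ifs with hi
      · intro _
        rw [Set.mem_Icc] at hi
        have := hf ((i : ℕ) - j₁) (by omega)
        omega
      · intro h; exact absurd rfl h
  refine natDegree_det_le_of_forall_perm _ _ fun σ hσ ↦ ?_
  have h1 : ∑ j, ((sylvester f g m n (σ j) j).natDegree + (σ j : ℕ)) ≤ ∑ j, w j :=
    Finset.sum_le_sum fun j _ ↦ hentry (σ j) j (hσ j)
  rw [Finset.sum_add_distrib] at h1
  have h2 : ∑ j, ((σ j : Fin (m + n)) : ℕ) = ∑ j : Fin (m + n), (j : ℕ) :=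
    Equiv.sum_comp σ (fun j ↦ (j : ℕ))
  rw [h2, hw] at h1
  -- `∑_{j < m+n} j = ∑_{j<m} j + ∑_{j<n} j + mn`
  have h3 : ∑ j : Fin (m + n), (j : ℕ) = ∑ j₁ : Fin m, (j₁ : ℕ) + ∑ j₁ : Fin n, (j₁ : ℕ) + m * n := by
    rw [Fin.sum_univ_add]
    simp only [Fin.val_castAdd, Fin.val_natAdd, Finset.sum_add_distrib, Finset.sum_const,
      Finset.card_univ, Fintype.card_fin, smul_eq_mul]
    ring
  omega

end Resultant

/-! ### Inseparable fibres of a plane model -/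

section Fibres

variable {K : Type*} [Field K]

/-- The total-degree condition passes to the `Y`-derivative: if `deg_X (coeff_i Φ) + i ≤ d` for
`i < d = deg_Y Φ` and `Φ` is monic, then `deg_X (coeff_k ∂Φ/∂Y) + k ≤ d - 1` for `k ≤ d - 1`.
[folklore] -/
theorem natDegree_coeff_derivative_add_le {Φ : K[X][Y]} (hm : Φ.Monic)
    (hdeg : ∀ i, i < Φ.natDegree → (Φ.coeff i).natDegree + i ≤ Φ.natDegree)
    (k : ℕ) (hk : k ≤ Φ.natDegree - 1) (hd : 1 ≤ Φ.natDegree) :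
    ((derivative Φ).coeff k).natDegree + k ≤ Φ.natDegree - 1 := by
  rw [coeff_derivative]
  by_cases hk1 : k + 1 < Φ.natDegree
  · have h1 := hdeg (k + 1) hk1
    have h2 : (Φ.coeff (k + 1) * ((k : K[X]) + 1)).natDegree ≤ (Φ.coeff (k + 1)).natDegree := by
      have : ((k : K[X]) + 1) = C ((k : K) + 1) := by simp
      rw [this]
      exact natDegree_mul_C_le _ _
    omega
  · have hk2 : k + 1 = Φ.natDegree := by omega
    rw [hk2, hm.coeff_natDegree, one_mul]
    have : ((k : K[X]) + 1) = C ((k : K) + 1) := by simp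
    rw [this, natDegree_C]
    omega

/-- The coefficients of a monic `Φ` of total degree `deg_Y Φ` satisfy the weighted bound for all
`k ≤ d`. [folklore] -/
theorem natDegree_coeff_add_le_of_monic {Φ : K[X][Y]} (hm : Φ.Monic)
    (hdeg : ∀ i, i < Φ.natDegree → (Φ.coeff i).natDegree + i ≤ Φ.natDegree)
    (k : ℕ) (hk : k ≤ Φ.natDegree) : (Φ.coeff k).natDegree + k ≤ Φ.natDegree := by
  rcases hk.lt_or_eq with h | h
  · exact hdeg k h
  · rw [h, hm.coeff_natDegree, natDegree_one, zero_add]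

/-- **At most `d(d-1)` inseparable fibres.** Let `Φ ∈ K[X][Y]` be monic of degree `d` in `Y`
with `deg_X (coeff of Yⁱ) + i ≤ d` for `i < d`, and separable as a polynomial over `K(X)`. Then
for all but at most `d(d-1)` values `a ∈ K` (`K` finite) the fibre polynomial `Φ(a, Y) ∈ K[Y]`
is separable: the exceptional `a` are roots of `R = Res_Y(Φ, ∂Φ/∂Y) ∈ K[X]`, which is non-zero
(separability over `K(X)`) of degree `≤ d(d-1)` (`natDegree_resultant_le_mul`). [folklore] -/
theorem card_filter_not_separable_le [Fintype K] {Φ : K[X][Y]} (hm : Φ.Monic)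
    (hdeg : ∀ i, i < Φ.natDegree → (Φ.coeff i).natDegree + i ≤ Φ.natDegree)
    (hsep : (Φ.map (algebraMap K[X] (RatFunc K))).Separable) :
    (Finset.univ.filter fun a : K ↦ ¬ (Φ.map (evalRingHom a)).Separable).card ≤
      Φ.natDegree * (Φ.natDegree - 1) := by
  set d := Φ.natDegree with hd
  by_cases hd0 : d = 0
  · -- `Φ = 1`: every fibre is separable
    have hΦ : Φ = 1 := eq_one_of_monic_natDegree_zero hm hd0.symm.symm
    have : (Finset.univ.filter fun a : K ↦ ¬ (Φ.map (evalRingHom a)).Separable) = ∅ := by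
      refine Finset.filter_false_of_mem fun a _ ↦ ?_
      rw [not_not, hΦ, Polynomial.map_one]
      exact separable_one
    rw [this, Finset.card_empty]
    exact Nat.zero_le _
  have hd1 : 1 ≤ d := Nat.one_le_iff_ne_zero.2 hd0
  set R : K[X] := resultant Φ (derivative Φ) d (d - 1) with hR
  -- `R ≠ 0` by separability over `K(X)`
  have hR0 : R ≠ 0 := by
    intro h0
    set φ := algebraMap K[X] (RatFunc K) with hφ
    set ΦL := Φ.map φ with hΦL
    have hmL : ΦL.Monic := hm.map φ
    have hdL : ΦL.natDegree = d := hm.natDegree_map φ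
    have hres : resultant ΦL (derivative ΦL) d (d - 1) = 0 := by
      rw [hΦL, derivative_map, resultant_map_map, ← hR, h0, map_zero]
    have hne : resultant ΦL (derivative ΦL) ΦL.natDegree (derivative ΦL).natDegree ≠ 0 :=
      resultant_ne_zero _ _ hsep
    obtain ⟨k, hk⟩ : ∃ k, d - 1 = (derivative ΦL).natDegree + k :=
      ⟨d - 1 - (derivative ΦL).natDegree, by
        have := natDegree_derivative_le ΦL; rw [hdL] at this; omega⟩
    rw [hk, resultant_add_right_deg _ _ _ _ k le_rfl, ← hdL] at hres
    rw [show ΦL.coeff ΦL.natDegree = 1 from hmL.coeff_natDegree, one_pow, one_mul] at hres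
    exact hne hres
  -- degree bound
  have hRdeg : R.natDegree ≤ d * (d - 1) :=
    natDegree_resultant_le_mul Φ (derivative Φ) d (d - 1)
      (fun k hk ↦ natDegree_coeff_add_le_of_monic hm hdeg k hk)
      (fun k hk ↦ natDegree_coeff_derivative_add_le hm hdeg k hk hd1)
  -- inseparable fibres are roots of `R`
  have hroot : ∀ a : K, ¬ (Φ.map (evalRingHom a)).Separable → R.IsRoot a := by
    intro a ha
    set Φa := Φ.map (evalRingHom a) with hΦa
    have hma : Φa.Monic := hm.map _
    have hda : Φa.natDegree = d := hm.natDegree_map _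
    by_contra hne
    rw [IsRoot.def] at hne
    have h1 : resultant Φa (derivative Φa) d (d - 1) = R.eval a := by
      rw [hΦa, derivative_map, resultant_map_map, coe_evalRingHom]
    obtain ⟨k, hk⟩ : ∃ k, d - 1 = (derivative Φa).natDegree + k :=
      ⟨d - 1 - (derivative Φa).natDegree, by
        have := natDegree_derivative_le Φa; rw [hda] at this; omega⟩
    rw [hk, resultant_add_right_deg _ _ _ _ k le_rfl, ← hda,
      show Φa.coeff Φa.natDegree = 1 from hma.coeff_natDegree, one_pow, one_mul] at h1
    have h2 : resultant Φa (derivative Φa) Φa.natDegree (derivative Φa).natDegree ≠ 0 := by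
      rw [h1]; exact hne
    rw [Ne, resultant_eq_zero_iff, not_and, not_not] at h2
    exact ha (h2 (Or.inl hma.ne_zero))
  calc (Finset.univ.filter fun a : K ↦ ¬ (Φ.map (evalRingHom a)).Separable).card
      ≤ R.roots.toFinset.card := by
        refine Finset.card_le_card fun a ha ↦ ?_
        rw [Finset.mem_filter] at ha
        rw [Multiset.mem_toFinset, mem_roots hR0]
        exact hroot a ha.2
    _ ≤ R.natDegree := (Multiset.toFinset_card_le _).trans (card_roots' R)
    _ ≤ d * (d - 1) := hRdeg

/-! ### Counting the zeros of `Φ` fibre by fibre -/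

/-- `#{(a, b) ∈ K² : Φ(a, b) = 0} = ∑_{a ∈ K} #{b ∈ K : Φ(a, b) = 0}`. [folklore] -/
theorem card_filter_evalEval_eq_sum [Fintype K] (Φ : K[X][Y]) :
    (Finset.univ.filter fun p : K × K ↦ Φ.evalEval p.1 p.2 = 0).card =
      ∑ a : K, (Finset.univ.filter fun b : K ↦ Φ.evalEval a b = 0).card := by
  simp only [Finset.card_filter]
  rw [Fintype.sum_prod_type]

/-- Each fibre of a monic plane model of degree `d` in `Y` has at most `d` rational points:
`#{b ∈ K : Φ(a, b) = 0} ≤ d`. [folklore] -/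
theorem card_filter_evalEval_le [Fintype K] {Φ : K[X][Y]} (hm : Φ.Monic) (a : K) :
    (Finset.univ.filter fun b : K ↦ Φ.evalEval a b = 0).card ≤ Φ.natDegree := by
  set Φa := Φ.map (evalRingHom a) with hΦa
  have hma : Φa.Monic := hm.map _
  calc (Finset.univ.filter fun b : K ↦ Φ.evalEval a b = 0).card ≤ Φa.roots.toFinset.card := by
        refine Finset.card_le_card fun b hb ↦ ?_
        rw [Finset.mem_filter] at hb
        rw [Multiset.mem_toFinset, mem_roots hma.ne_zero, IsRoot.def, hΦa, map_evalRingHom_eval]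
        exact hb.2
    _ ≤ Φa.natDegree := (Multiset.toFinset_card_le _).trans (card_roots' Φa)
    _ = Φ.natDegree := hm.natDegree_map _

end Fibres

end Literature.NumberTheory.DiophantineGeometry
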